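import Summits.QuantumFields.BalabanUV.T4Continuum.Support.NE7QbarEnergyLetter
import HarnessLib

/-!
# NE7StraightTowerCurlEnergy — THE COARSE MAXWELL ENERGY OF THE STRAIGHT (DOUBLE-BAR) PART OF THE k-FOLD LINEARISED AVERAGE AT A SMALL-FIELD BACKGROUND, ALL LEVELS, ROOT FORM:
# `√(Σ_P ‖curl_{W_{j+1}}(Q̄^{(j+1)}_W Y)(P)‖²_{HS∕n}) ≤ √(L⁴∕L^d)^{j+1}·√(Σ_p ‖curl_W Y(p)‖²_{HS∕n}) + towerB(d,L,n; j, x)·√(Σ_b ‖Y(b)‖²_{HS∕n})`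
# (lineage `b2b-balaban-t4-ne7-p1`, gen 117, file F4; ROAD-G116 §7∕§9 (G1) — the multi-level curved commutation letter, FRAME-CORRECTED)

Cell `pub-balaban`, rung (B)+1 sub-cell t4, CRUX PROVER NE7 #1 (OWNER of row NE7), generation 117.  `W_{m} = cavgIter L m W` (the background tower, plaquette radii
`x_m = radIter m x` by B7 Prop. 1), `Q̄^{(m)} = QbarIter L m W Y` (the straight double-bar tower); the full linearised k-fold average is `dirIter = QbarIter + gaugeDir (cavgIter) (framePotW)`
(✓ `NE3TangentCovariantTower.dirIter_eq_QbarIter_add_gaugeDir`), and the dressed curl of the frame part is the EXACT plaquette commutator `G(z) − Ad_{W_{j+1}(∂P)} G(z)`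
(✓ `curlAt_gaugeDir`) — it is NOT controlled by the fine energy or the scaled fine mass (corner-charge gauge directions; this generation's memo), which is why the k-level letter is
stated for the STRAIGHT part.
THE LETTER (induction on the tower, peeling the bottom step; inputs BY NAME: F3c ✓ `sqrt_curl_energy_Qbar_le` (energy, one step, root form), F3b ✓ `sqrt_qbar_mass_le_curved` (mass, one step,
root form), ✓ `step_small`, ✓ `isPeriodicCfg_cavg`, ✓ `Qbar_add_period`): for `W` unitary `(tower L N (j+1))`-periodic with `0 ≤ x`, `LevelSmall d L j x`, `SmallField W x`, and `Y`
`(tower L N (j+1))`-periodic,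
  `√E_{j+1} ≤ √(L⁴∕L^d)^{j+1}·√E_0 + towerB d L ν j x · √N_0`,  `ν = card n`,
`E_0 = Σ_{p∈perWin (tower L N (j+1))} nhsNormSq (curl W Y p)`, `E_{j+1} = Σ_{P∈perWin N} nhsNormSq (curl (cavgIter L (j+1) W) (QbarIter L (j+1) W Y) P)`, `N_0 = Σ_{b} nhsNormSq (Y b)` on the
period box, and `towerB` the explicit recursion `towerB 0 x = eC·x`, `towerB (j+1) x = √(L⁴∕L^d)^{j+1}·eC·x + towerB j (prop1Radius x)·(√(L²∕L^d) + mC·x)` — i.e.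
`towerB j x = Σ_{m≤j} √(L⁴∕L^d)^{j−m}·eC·x_m·Π_{l<m}(√(L²∕L^d) + mC·x_l)`: NO multiplicative loss on the main term, and in `d = 4` with the class radii `x_m ≤ 2ε·L^{−2(j+1−m)}`
(✓ `NE7RadIterUniform`) the remainder is `O(ε)·L^{−(j+1)}·√N_0` — the SCALED fine mass, j-UNIFORMLY (geometric series; evaluation left to the consumer∕successor).
HONEST FRAMING: lattice kinematics of the averaging tower on OUR objects; constants polynomial in `d, L, card n`, not optimised; nothing of Bałaban's asserted ((48), (120) context only);
NOT (G′), NOT NE7 as a spine node, NOT NE3; spine 0∕9; finite T⁴ rung (B)+1 — NOT infinite volume, NOT mass gap, NOT BetaPertH, NOT Clay.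
-/

set_option autoImplicit false

open scoped BigOperators Matrix.Norms.L2Operator
open NormedSpace Finset

namespace Summit.QuantumFields.BalabanUV.T4Continuum.NE7StraightTowerCurlEnergy

open Literature.MathematicalPhysics.QuantumFieldTheory.Balaban1983to89
open B7Prop1Explicit B7Prop2Explicit MatrixLog UnitaryModel
open T4AveragingDeficitWall (IsUnitaryCfg SmallField curl curlAt dirSq)
open T4AveragingDeficitWallBoundary (IsPeriodicCfg periodBox)
open AveragingDeficitPeriodicCounting (IsPeriodicDir)
open AveragingDeficitChartCalculus (cavg)
open AveragingDeficitTwoLevelPrep (twoLevelSmall prop1Radius)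
open AveragingDeficitMultiLevelPrep (cavgIter tower LevelSmall natCast_tower_succ tower_ne_zero prop1Radius_nonneg)
open AveragingDeficitFermat (isPeriodicCfg_cavg)
open MatrixNorms (nhsNormSq nhsNormSq_nonneg opNorm_sq_le_card_mul_nhsNormSq)
open MinimalActionLevels (perWin)
open SpreadLift (loopRad)
open NE3TangentCovariantStructure (Qbar Qbar_add_period)
open NE3TangentCovariantTower (QbarIter QbarIter_succ QbarIter_one cavgIter_one step_small)
open NE3EnergyHessContTwoTerm (dirSq_nonneg)
open NE7CoarseCurlEnergyCurved (energyErrC energyErrC_nonneg)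
open NE7QbarMassLetter (massErrC massRemC massErrC_nonneg massRemC_nonneg sqrt_qbar_mass_le_curved)
open NE7QbarEnergyLetter (qbarCurlC qbarCurlC_nonneg sqrt_curl_energy_Qbar_le)

noncomputable section

variable {d : ℕ} {n : Type*} [Fintype n] [DecidableEq n]

/-! ## §1 The constants and the recursion `towerB` -/

/-- THE ONE-STEP ENERGY REMAINDER CONSTANT in HS-mass currency: `eC d L ν = √energyErrC·qbarCurlC·√ν` (`ν = card n` converts `dirSq` to the HS mass). [folklore] -/
def eC (d L : ℕ) (ν : ℝ) : ℝ := Real.sqrt (energyErrC d L) * qbarCurlC d L * Real.sqrt ν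

/-- THE ONE-STEP MASS REMAINDER CONSTANT in HS-mass currency: `mC d L ν = √massErrC·massRemC·16(d+1)(d+4)L²·√ν` (`loopRad d L x = 16(d+1)(d+4)L²·x`). [folklore] -/
def mC (d L : ℕ) (ν : ℝ) : ℝ := Real.sqrt (massErrC d L) * massRemC d L * (16 * ((d : ℝ) + 1) * ((d : ℝ) + 4) * (L : ℝ) ^ 2) * Real.sqrt ν

/-- THE TOWER REMAINDER COEFFICIENT, by recursion on the number of levels (peeling the bottom step):
`towerB 0 x = eC·x`, `towerB (j+1) x = √(L⁴∕L^d)^{j+1}·eC·x + towerB j (prop1Radius x)·(√(L²∕L^d) + mC·x)`. [folklore] -/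
def towerB (d L : ℕ) (ν : ℝ) : ℕ → ℝ → ℝ
  | 0, x => eC d L ν * x
  | j + 1, x => Real.sqrt ((L : ℝ) ^ 4 / (L : ℝ) ^ d) ^ (j + 1) * (eC d L ν * x) + towerB d L ν j (prop1Radius d L x) * (Real.sqrt ((L : ℝ) ^ 2 / (L : ℝ) ^ d) + mC d L ν * x)

omit [Fintype n] [DecidableEq n] in
/-- `0 ≤ eC`. [folklore] -/
theorem eC_nonneg (d L : ℕ) {ν : ℝ} : 0 ≤ eC d L ν := by
  unfold eC; have := qbarCurlC_nonneg d L; positivity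

omit [Fintype n] [DecidableEq n] in
/-- `0 ≤ mC`. [folklore] -/
theorem mC_nonneg (d L : ℕ) {ν : ℝ} : 0 ≤ mC d L ν := by
  unfold mC; have := massRemC_nonneg d L; positivity

omit [Fintype n] [DecidableEq n] in
/-- `0 ≤ towerB d L ν j x` for `x ≥ 0`. [folklore] -/
theorem towerB_nonneg (d L : ℕ) {ν : ℝ} : ∀ (j : ℕ) {x : ℝ}, 0 ≤ x → 0 ≤ towerB d L ν j x
  | 0, x, hx => by unfold towerB; exact mul_nonneg (eC_nonneg d L) hx
  | j + 1, x, hx => by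
      unfold towerB
      have h1 := towerB_nonneg d L (ν := ν) j (prop1Radius_nonneg (d := d) (L := L) hx)
      have h2 := eC_nonneg d L (ν := ν)
      have h3 := mC_nonneg d L (ν := ν)
      positivity

/-! ## §2 One step in HS-mass currency -/

/-- `√(dirSq Y F) ≤ √(card n)·√(Σ_{x∈F} Σ_κ nhsNormSq (Y x κ))` (operator norm against the normalised HS norm). [folklore] -/
theorem sqrt_dirSq_le (Y : Site d → Fin d → Matrix n n ℂ) (F : Finset (Site d)) :
    Real.sqrt (dirSq Y F) ≤ Real.sqrt (Fintype.card n) * Real.sqrt (∑ x ∈ F, ∑ κ : Fin d, nhsNormSq (Y x κ)) := by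
  rw [← Real.sqrt_mul (Nat.cast_nonneg _)]
  refine Real.sqrt_le_sqrt ?_
  unfold T4AveragingDeficitWall.dirSq
  rw [Finset.mul_sum]
  refine Finset.sum_le_sum fun x _ => ?_
  rw [Finset.mul_sum]
  exact Finset.sum_le_sum fun κ _ => opNorm_sq_le_card_mul_nhsNormSq _

/-- **ONE STEP, ENERGY, HS-mass currency**: `√E(cavg W, Qbar W Y; M) ≤ √(L⁴∕L^d)·√E(W, Y; L·M) + eC·x·√N(Y; L·M)`. [folklore] -/
theorem sqrt_energy_step [Nonempty n] {L M : ℕ} [NeZero L] (hL : 1 ≤ L) (hM : 1 ≤ M) {W : Site d → Fin d → (Matrix n n ℂ)ˣ}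
    (hW : IsUnitaryCfg W) (hWP : IsPeriodicCfg W ((L : ℤ) * M)) {x : ℝ} (hx : 0 ≤ x) (h512 : 512 * (d + 1) * (d + 4) * (L : ℝ) ^ 2 * x ≤ 1)
    (hWx : SmallField W x) {Y : Site d → Fin d → Matrix n n ℂ} (hYP : IsPeriodicDir Y ((L : ℤ) * M)) :
    Real.sqrt (∑ P ∈ perWin d M, nhsNormSq (curl (cavg L W) (Qbar L W Y) P))
      ≤ Real.sqrt ((L : ℝ) ^ 4 / (L : ℝ) ^ d) * Real.sqrt (∑ p ∈ perWin d (L * M), nhsNormSq (curl W Y p))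
        + eC d L (Fintype.card n) * x * Real.sqrt (∑ b ∈ periodBox (L * M), ∑ κ : Fin d, nhsNormSq (Y b κ)) := by
  have h := sqrt_curl_energy_Qbar_le hL hM hW hWP hx h512 hWx hYP
  refine h.trans (add_le_add le_rfl ?_)
  have hs := sqrt_dirSq_le Y (periodBox (L * M))
  have hK : 0 ≤ Real.sqrt (energyErrC d L) * (qbarCurlC d L * x) := by have := qbarCurlC_nonneg d L; positivity
  calc Real.sqrt (energyErrC d L) * (qbarCurlC d L * x) * Real.sqrt (dirSq Y (periodBox (L * M)))
      ≤ Real.sqrt (energyErrC d L) * (qbarCurlC d L * x) * (Real.sqrt (Fintype.card n) * Real.sqrt (∑ b ∈ periodBox (L * M), ∑ κ : Fin d, nhsNormSq (Y b κ))) :=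
        mul_le_mul_of_nonneg_left hs hK
    _ = eC d L (Fintype.card n) * x * Real.sqrt (∑ b ∈ periodBox (L * M), ∑ κ : Fin d, nhsNormSq (Y b κ)) := by unfold eC; ring

/-- **ONE STEP, MASS, HS-mass currency**: `√N(Qbar W Y; M) ≤ (√(L²∕L^d) + mC·x)·√N(Y; L·M)`. [folklore] -/
theorem sqrt_mass_step [Nonempty n] {L M : ℕ} [NeZero L] (hL : 1 ≤ L) (hM : 1 ≤ M) {W : Site d → Fin d → (Matrix n n ℂ)ˣ}
    (hW : IsUnitaryCfg W) {x : ℝ} (hx : 0 ≤ x) (h512 : 512 * (d + 1) * (d + 4) * (L : ℝ) ^ 2 * x ≤ 1)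
    (hWx : SmallField W x) {Y : Site d → Fin d → Matrix n n ℂ} (hYP : IsPeriodicDir Y ((L : ℤ) * M)) :
    Real.sqrt (∑ z ∈ periodBox M, ∑ κ : Fin d, nhsNormSq (Qbar L W Y z κ))
      ≤ (Real.sqrt ((L : ℝ) ^ 2 / (L : ℝ) ^ d) + mC d L (Fintype.card n) * x) * Real.sqrt (∑ b ∈ periodBox (L * M), ∑ κ : Fin d, nhsNormSq (Y b κ)) := by
  have h := sqrt_qbar_mass_le_curved hL hM hW hx h512 hWx hYP
  refine h.trans ?_
  rw [add_mul]
  refine add_le_add le_rfl ?_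
  have hs := sqrt_dirSq_le Y (periodBox (L * M))
  have hK : 0 ≤ Real.sqrt (massErrC d L) * (massRemC d L * loopRad d L x) := by
    have := massRemC_nonneg d L; unfold SpreadLift.loopRad; positivity
  calc Real.sqrt (massErrC d L) * (massRemC d L * loopRad d L x) * Real.sqrt (dirSq Y (periodBox (L * M)))
      ≤ Real.sqrt (massErrC d L) * (massRemC d L * loopRad d L x) * (Real.sqrt (Fintype.card n) * Real.sqrt (∑ b ∈ periodBox (L * M), ∑ κ : Fin d, nhsNormSq (Y b κ))) :=
        mul_le_mul_of_nonneg_left hs hK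
    _ = mC d L (Fintype.card n) * x * Real.sqrt (∑ b ∈ periodBox (L * M), ∑ κ : Fin d, nhsNormSq (Y b κ)) := by
        unfold mC SpreadLift.loopRad; ring

/-! ## §3 The tower -/

/-- **THE STRAIGHT TOWER'S COARSE MAXWELL ENERGY, ALL LEVELS, ROOT FORM** (tower class: `W` unitary `(tower L N (j+1))`-periodic, `0 ≤ x`, `LevelSmall d L j x`, `SmallField W x`;
`Y` `(tower L N (j+1))`-periodic):
`√(Σ_{P∈perWin N} nhsNormSq (curl (cavgIter L (j+1) W) (QbarIter L (j+1) W Y) P)) ≤ √(L⁴∕L^d)^{j+1}·√(Σ_{p∈perWin (tower L N (j+1))} nhsNormSq (curl W Y p)) + towerB d L (card n) j x·√(Σ_{b∈periodBox (tower L N (j+1))} Σ_κ nhsNormSq (Y b κ))`.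
[cite: Balaban1985Averaging, (48) p.25, (120) p.35] -/
theorem sqrt_curl_energy_QbarIter_le [Nonempty n] {L N : ℕ} [NeZero L] (hL : 1 ≤ L) (hN : 1 ≤ N) :
    ∀ (j : ℕ) {W : Site d → Fin d → (Matrix n n ℂ)ˣ} {x : ℝ}, IsUnitaryCfg W → IsPeriodicCfg W ((tower L N (j + 1) : ℕ) : ℤ) → 0 ≤ x →
    LevelSmall d L j x → SmallField W x →
    ∀ {Y : Site d → Fin d → Matrix n n ℂ}, IsPeriodicDir Y ((tower L N (j + 1) : ℕ) : ℤ) →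
      Real.sqrt (∑ P ∈ perWin d N, nhsNormSq (curl (cavgIter L (j + 1) W) (QbarIter L (j + 1) W Y) P))
        ≤ Real.sqrt ((L : ℝ) ^ 4 / (L : ℝ) ^ d) ^ (j + 1) * Real.sqrt (∑ p ∈ perWin d (tower L N (j + 1)), nhsNormSq (curl W Y p))
          + towerB d L (Fintype.card n) j x * Real.sqrt (∑ b ∈ periodBox (tower L N (j + 1)), ∑ κ : Fin d, nhsNormSq (Y b κ)) := by
  intro j
  induction j with
  | zero =>
      intro W x hWu hWP hx hsm hWx Y hYP
      obtain ⟨h512, -, -, -⟩ := step_small hL hWu hx hsm.two hWx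
      have hWP' : IsPeriodicCfg W ((L : ℤ) * N) := by
        have e : ((tower L N (0 + 1) : ℕ) : ℤ) = (L : ℤ) * N := by rw [natCast_tower_succ]; rfl
        rw [← e]; exact hWP
      have hYP' : IsPeriodicDir Y ((L : ℤ) * N) := by
        have e : ((tower L N (0 + 1) : ℕ) : ℤ) = (L : ℤ) * N := by rw [natCast_tower_succ]; rfl
        rw [← e]; exact hYP
      have h := sqrt_energy_step hL hN hWu hWP' hx h512 hWx hYP'
      rw [zero_add, pow_one, QbarIter_one, cavgIter_one]
      unfold towerB
      exact h
  | succ j ih =>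
      intro W x hWu hWP hx hsm hWx Y hYP
      obtain ⟨h512, hU', hx', hS'⟩ := step_small hL hWu hx hsm.1 hWx
      have hWP1 : IsPeriodicCfg W ((L : ℤ) * ((tower L N (j + 1) : ℕ) : ℤ)) := by rw [← natCast_tower_succ]; exact hWP
      have hYP1 : IsPeriodicDir Y ((L : ℤ) * ((tower L N (j + 1) : ℕ) : ℤ)) := by rw [← natCast_tower_succ]; exact hYP
      have hWP' : IsPeriodicCfg (cavg L W) ((tower L N (j + 1) : ℕ) : ℤ) := isPeriodicCfg_cavg L _ hWP1
      have hYP' : IsPeriodicDir (Qbar L W Y) ((tower L N (j + 1) : ℕ) : ℤ) := fun z i κ => Qbar_add_period L hWP1 hYP1 z i κ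
      have hT1 : 1 ≤ tower L N (j + 1) := Nat.one_le_iff_ne_zero.mpr (by
        haveI : NeZero N := ⟨by omega⟩
        exact tower_ne_zero L N (j + 1))
      -- the remaining tower at the averaged background
      have hih := ih hU' hWP' hx' hsm.2 hS' hYP'
      -- the bottom step
      have hE := sqrt_energy_step hL hT1 hWu hWP1 hx h512 hWx hYP1
      have hM := sqrt_mass_step hL hT1 hWu hx h512 hWx hYP1
      have eT : L * tower L N (j + 1) = tower L N (j + 1 + 1) := rfl
      rw [eT] at hE hM
      rw [QbarIter_succ, NE3TangentCovariantTower.cavgIter_succ]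
      refine hih.trans ?_
      -- names
      set e₁ := Real.sqrt (∑ p ∈ perWin d (tower L N (j + 1)), nhsNormSq (curl (cavg L W) (Qbar L W Y) p)) with he₁
      set m₁ := Real.sqrt (∑ b ∈ periodBox (tower L N (j + 1)), ∑ κ : Fin d, nhsNormSq (Qbar L W Y b κ)) with hm₁
      set e₀ := Real.sqrt (∑ p ∈ perWin d (tower L N (j + 1 + 1)), nhsNormSq (curl W Y p)) with he₀
      set m₀ := Real.sqrt (∑ b ∈ periodBox (tower L N (j + 1 + 1)), ∑ κ : Fin d, nhsNormSq (Y b κ)) with hm₀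
      set q : ℝ := Real.sqrt ((L : ℝ) ^ 4 / (L : ℝ) ^ d) with hq
      set B' := towerB d L (Fintype.card n) j (prop1Radius d L x) with hB'
      have hq0 : 0 ≤ q := Real.sqrt_nonneg _
      have hB'0 : 0 ≤ B' := towerB_nonneg d L (ν := (Fintype.card n : ℝ)) j hx'
      have hm₀0 : 0 ≤ m₀ := Real.sqrt_nonneg _
      calc q ^ (j + 1) * e₁ + B' * m₁
          ≤ q ^ (j + 1) * (q * e₀ + eC d L (Fintype.card n) * x * m₀) + B' * ((Real.sqrt ((L : ℝ) ^ 2 / (L : ℝ) ^ d) + mC d L (Fintype.card n) * x) * m₀) :=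
            add_le_add (mul_le_mul_of_nonneg_left hE (pow_nonneg hq0 _)) (mul_le_mul_of_nonneg_left hM hB'0)
        _ = q ^ (j + 1 + 1) * e₀ + towerB d L (Fintype.card n) (j + 1) x * m₀ := by
            rw [towerB]; ring

end

end Summit.QuantumFields.BalabanUV.T4Continuum.NE7StraightTowerCurlEnergy
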